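import Summits.BirchSwinnertonDyer.BirchSwinnertonDyer.Theorems.ResidualThetaTransportAtTwoPollackPairKUnique
import Literature.NumberTheory.EllipticCurves.GreenbergSelmerCharIdealPrincipalProofs
import HarnessLib

/-!
# Sketch (stub-ideation k1 g26) — stub `stub_cmLambdaLower` of line «bt26-lambda», crux (R≥)ᵖ stmt-BirchSwinnertonDyer-26074
# F-q: the values constant `q : PadicAlgCl 2` of the (i)-half texts of record versus the `𝒪_K`-typed relay K-β —
# WEAKEST SUFFICIENT FORM: `q ∈ ℚ̄₂ˣ` as typed suffices (base-extend the coefficient set by `q`, run the relay there, descend by ONE coefficient).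

HONEST FRAMING. THEOREMS ONLY, sorry-free, `--supports` material at most; nothing about any curve, Selmer group or `L`-value is asserted;
BSD is NOT proved by any of this. The texts of record of the (i)-half (`KatoValCoord`/`KatoValuedClass`, defs module p714847) type the
values constant as `q : PadicAlgCl 2`, while the LANDED relay `ThetaTransport.MazurTateValuesRelay.C_mul_mul_eq_mul_of_congruences` and every
λ-count live over `𝒪 = padicCoeffIntegers (Set.range ι)`. This file shows no descent / K-rationality INPUT is needed (§0 = local copies of the landed relay §1, see there):

* §A change of coefficient set `S ⊆ S'`: `inclO`, `inclΛ`, `IsCongrModOmegaO.of_subset`, `inclΛ_coe_map` (plumbing);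
* §B the even Mazur–Tate congruences of an `𝒪`-Pollack pair hold over any `S' ⊇ range ι` (`IsPollackPairK.even_congr_of_subset`);
* §C the relay K-β with a GENERIC coefficient set `S` and a generic left family `θ m` (`C_mul_mul_eq_mul_of_congruences_gen`, verbatim port of the
  landed proof; the landed theorem is the case `S = range ι`, `θ m = θ_{2m}(g)^ι`);
* §D `u := p^a·q ∈ 𝒪_{S ∪ {q}}` (`exists_natCast_pow_mul_mem_padicCoeffIntegers`, `mem_padicCoeffField_union_singleton`);
* §E ONE-COEFFICIENT DESCENT: `inclΛ F = C u · inclΛ G`, `G ≠ 0` ⟹ `u ∈ 𝒪_S` and `F = C u₀ · G` over `S` (`exists_eq_C_mul_of_inclΛ_eq`);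
* §F the packaged q-elimination `relay_descends`: Pollack pair over `range ι` + column congruences over `range ι` + MTV_Λ over `S' ⊇ range ι`
  with multiplier `C u · μt` ⟹ `∃ u₀ ∈ 𝒪_{range ι}, u = u₀ ∧ C ν · w · E = C u₀ · μt · L⁻` — station (R) of the k3-g24 interior over `𝒪_K`,
  and `q ∈ K·2^ℤ` a posteriori. Finite-dimensionality of `ℚ₂(range ι ∪ {q})`: `finiteDimensional_padicCoeffField_range_union_singleton` (tree).

References: [cite: Pollack2003, Thm. 5.1, Prop. 6.18]; [cite: Kato2004Asterisque, Thm. 12.5 (1) (p. 221), Thm. 16.6.2 (p. 268)];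
[cite: EmertonPollackWeston2006, §3.1 (p. 17)]; [cite: Washington1997, §7.1].
-/

set_option autoImplicit false
-- D-0017: single-problem summit, so `Summit.BirchSwinnertonDyer.BirchSwinnertonDyer.…` repeats a namespace BY DESIGN.
set_option linter.dupNamespace false

noncomputable section

open scoped Classical Polynomial

namespace Summit.BirchSwinnertonDyer.BirchSwinnertonDyer.Cruxes.ResidualThetaCountLowerPureAtTwo.SideaK1G26

open Polynomial (X)
open Literature.NumberTheory.EllipticCurves Literature.NumberTheory.EllipticCurves.ModularForms CongruenceSubgroup
  Literature.NumberTheory.Automorphic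
  Summit.BirchSwinnertonDyer.BirchSwinnertonDyer.Theorems.PollackPairK

variable {p : ℕ} [hp : Fact p.Prime]

/-! ## §0 LOCAL COPIES of the landed relay's §1 (`Theorems/…ResidualSignedLambdaLowerCMAtTwoMazurTateValuesRelay.lean`, ns
`…Theorems.ThetaTransport.MazurTateValuesRelay`, w2 g21) — verbatim; present ONLY because the farm snapshot used by `lean check` had not yet built that
module when this sketch was checked (remote:stale:1249:unbuilt). A Theorems port imports the landed module and deletes this section. -/

section LocalCopies

variable {S : Set (PadicAlgCl p)}

/-- LOCAL COPY (landed relay §1). [cite: Pollack2003, Prop. 6.18 (shape of the congruences)] -/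
theorem congr_mul_of_isCongrModOmegaO {n : ℕ} {θ : (PadicAlgCl p)[X]} {P : PowerSeries (PadicAlgCl p)} {L : IwasawaAlgebraO S}
    (h : IsCongrModOmegaO S n θ (P * iwasawaOToPowerSeries S L)) (μt : IwasawaAlgebraO S) :
    ∃ (m : ℕ) (q : IwasawaAlgebraO S),
      PowerSeries.C ((p : PadicAlgCl p) ^ m) *
          (iwasawaOToPowerSeries S μt * (θ : PowerSeries (PadicAlgCl p)) - P * iwasawaOToPowerSeries S (μt * L)) =
        (((cyclotomicOmega p n).map (Int.castRingHom (PadicAlgCl p)) : (PadicAlgCl p)[X]) : PowerSeries (PadicAlgCl p)) *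
          iwasawaOToPowerSeries S q := by
  obtain ⟨m, q, e⟩ := h
  refine ⟨m, μt * q, ?_⟩
  rw [map_mul, map_mul]
  linear_combination (iwasawaOToPowerSeries S μt) * e

/-- LOCAL COPY (landed relay §1). [cite: Pollack2003, Prop. 6.18 (shape of the congruences)] -/
theorem congr_of_dvd_sub {n : ℕ} {Θ : PowerSeries (PadicAlgCl p)} {L₁ L₂ : IwasawaAlgebraO S}
    (h : ∃ (m : ℕ) (q : IwasawaAlgebraO S),
      PowerSeries.C ((p : PadicAlgCl p) ^ m) * (Θ - iwasawaOToPowerSeries S L₁) =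
        (((cyclotomicOmega p n).map (Int.castRingHom (PadicAlgCl p)) : (PadicAlgCl p)[X]) : PowerSeries (PadicAlgCl p)) *
          iwasawaOToPowerSeries S q)
    (hd : (((cyclotomicOmega p n).map (Int.castRingHom (padicCoeffIntegers S)) : (padicCoeffIntegers S)[X]) :
        IwasawaAlgebraO S) ∣ L₁ - L₂) :
    ∃ (m : ℕ) (q : IwasawaAlgebraO S),
      PowerSeries.C ((p : PadicAlgCl p) ^ m) * (Θ - iwasawaOToPowerSeries S L₂) =
        (((cyclotomicOmega p n).map (Int.castRingHom (PadicAlgCl p)) : (PadicAlgCl p)[X]) : PowerSeries (PadicAlgCl p)) *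
          iwasawaOToPowerSeries S q := by
  obtain ⟨m, q, e⟩ := h
  obtain ⟨r, hr⟩ := hd
  refine ⟨m, q + PowerSeries.C (((p : ℕ) : padicCoeffIntegers S) ^ m) * r, ?_⟩
  have hr' := congr_arg (iwasawaOToPowerSeries S) hr
  rw [map_sub, map_mul, iwasawaOToPowerSeries_coe_map] at hr'
  rw [map_add, map_mul, iwasawaOToPowerSeries_C_natCast_pow]
  linear_combination e + PowerSeries.C ((p : PadicAlgCl p) ^ m) * hr'

/-- LOCAL COPY (landed relay §1): rigidity for a power-series left member. [cite: Pollack2003, Prop. 6.18 (shape of the congruences)] -/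
theorem dvd_sub_of_congr_powerSeries [FiniteDimensional ℚ_[p] (padicCoeffField S)] {n : ℕ} {Θ : PowerSeries (PadicAlgCl p)}
    {c D ω' : ℤ[X]} (hc : c = 1 ∨ c = -1) (hD : D.Monic) (hω' : ω'.Monic) (hfac : cyclotomicOmega p n = D * ω')
    {L₁ L₂ : IwasawaAlgebraO S}
    (h₁ : ∃ (m : ℕ) (q : IwasawaAlgebraO S),
      PowerSeries.C ((p : PadicAlgCl p) ^ m) * (Θ -
          (((c * ω').map (Int.castRingHom (PadicAlgCl p)) : (PadicAlgCl p)[X]) : PowerSeries (PadicAlgCl p)) * iwasawaOToPowerSeries S L₁) =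
        (((cyclotomicOmega p n).map (Int.castRingHom (PadicAlgCl p)) : (PadicAlgCl p)[X]) : PowerSeries (PadicAlgCl p)) *
          iwasawaOToPowerSeries S q)
    (h₂ : ∃ (m : ℕ) (q : IwasawaAlgebraO S),
      PowerSeries.C ((p : PadicAlgCl p) ^ m) * (Θ -
          (((c * ω').map (Int.castRingHom (PadicAlgCl p)) : (PadicAlgCl p)[X]) : PowerSeries (PadicAlgCl p)) * iwasawaOToPowerSeries S L₂) =
        (((cyclotomicOmega p n).map (Int.castRingHom (PadicAlgCl p)) : (PadicAlgCl p)[X]) : PowerSeries (PadicAlgCl p)) *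
          iwasawaOToPowerSeries S q) :
    ((D.map (Int.castRingHom (padicCoeffIntegers S)) : (padicCoeffIntegers S)[X]) : IwasawaAlgebraO S) ∣ L₂ - L₁ := by
  haveI : IsDiscreteValuationRing (padicCoeffIntegers S) := isDiscreteValuationRing_padicCoeffIntegers
  haveI : CharP (IsLocalRing.ResidueField (padicCoeffIntegers S)) p := charP_residueField_padicCoeffIntegers
  obtain ⟨m₁, q₁, e₁⟩ := h₁
  obtain ⟨m₂, q₂, e₂⟩ := h₂
  have hr : PowerSeries.C (((p : ℕ) : padicCoeffIntegers S) ^ (m₁ + m₂)) *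
      ((((c * ω').map (Int.castRingHom (padicCoeffIntegers S)) : (padicCoeffIntegers S)[X]) : IwasawaAlgebraO S) * (L₂ - L₁)) =
      (((cyclotomicOmega p n).map (Int.castRingHom (padicCoeffIntegers S)) : (padicCoeffIntegers S)[X]) : IwasawaAlgebraO S) *
        (PowerSeries.C (((p : ℕ) : padicCoeffIntegers S) ^ m₂) * q₁ - PowerSeries.C (((p : ℕ) : padicCoeffIntegers S) ^ m₁) * q₂) := by
    apply iwasawaOToPowerSeries_injective S
    rw [map_mul, map_mul, map_sub, iwasawaOToPowerSeries_C_natCast_pow, iwasawaOToPowerSeries_coe_map, map_mul,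
      iwasawaOToPowerSeries_coe_map, map_sub, map_mul, map_mul, iwasawaOToPowerSeries_C_natCast_pow,
      iwasawaOToPowerSeries_C_natCast_pow, pow_add, map_mul]
    linear_combination (PowerSeries.C ((p : PadicAlgCl p) ^ m₂)) * e₁ - (PowerSeries.C ((p : PadicAlgCl p) ^ m₁)) * e₂
  set N := m₁ + m₂ with hN
  set r := PowerSeries.C (((p : ℕ) : padicCoeffIntegers S) ^ m₂) * q₁ - PowerSeries.C (((p : ℕ) : padicCoeffIntegers S) ^ m₁) * q₂ with hrdef
  set Dₒ : IwasawaAlgebraO S := (↑(D.map (Int.castRingHom (padicCoeffIntegers S))) : IwasawaAlgebraO S) with hDₒ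
  set ωₒ : IwasawaAlgebraO S := (↑(ω'.map (Int.castRingHom (padicCoeffIntegers S))) : IwasawaAlgebraO S) with hωₒ
  set cₒ : IwasawaAlgebraO S := (↑(c.map (Int.castRingHom (padicCoeffIntegers S))) : IwasawaAlgebraO S) with hcₒ
  set π : IwasawaAlgebraO S := PowerSeries.C (((p : ℕ) : padicCoeffIntegers S) ^ N) with hπ
  have hcu : cₒ * cₒ = 1 := by
    rcases hc with rfl | rfl <;> simp [hcₒ]
  have hωne : ωₒ ≠ 0 := by
    rw [hωₒ, Ne, Polynomial.coe_eq_zero_iff]; exact (hω'.map _).ne_zero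
  have e1 : (((c * ω').map (Int.castRingHom (padicCoeffIntegers S)) : (padicCoeffIntegers S)[X]) : IwasawaAlgebraO S) =
      cₒ * ωₒ := by
    rw [Polynomial.map_mul, Polynomial.coe_mul]
  have e2 : (((cyclotomicOmega p n).map (Int.castRingHom (padicCoeffIntegers S)) : (padicCoeffIntegers S)[X]) :
      IwasawaAlgebraO S) = Dₒ * ωₒ := by
    rw [hfac, Polynomial.map_mul, Polynomial.coe_mul]
  rw [e1, e2] at hr
  have h1 : ωₒ * (π * (cₒ * (L₂ - L₁))) = ωₒ * (Dₒ * r) := by linear_combination hr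
  have h2 := mul_left_cancel₀ hωne h1
  have h3 : π * (L₂ - L₁) = Dₒ * (cₒ * r) := by
    linear_combination cₒ * h2 - (π * (L₂ - L₁)) * hcu
  have hDred : PowerSeries.map (IsLocalRing.residue (padicCoeffIntegers S)) Dₒ ≠ 0 := by
    rw [hDₒ, map_residue_coe_eq_X_pow p hD ⟨ω', hfac⟩]; exact pow_ne_zero _ PowerSeries.X_ne_zero
  exact exists_eq_mul_of_C_mul_eq_mul_of_ne_zero (natCast_pow_ne_zero_padicCoeffIntegers N) hDred h3

end LocalCopies

/-! ## §A Change of coefficient set `S ⊆ S'` -/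

section BaseChange

variable {S S' : Set (PadicAlgCl p)}

/-- `𝒪_S ⊆ 𝒪_{S'}` for `S ⊆ S'`. [cite: EmertonPollackWeston2006, §3.1 (p. 17) (plumbing)] -/
theorem padicCoeffIntegers_mono (h : S ⊆ S') : padicCoeffIntegers S ≤ padicCoeffIntegers S' :=
  fun _ hx ↦ ⟨IntermediateField.adjoin.mono ℚ_[p] S S' h hx.1, hx.2⟩

/-- The inclusion `𝒪_S →+* 𝒪_{S'}` (THEOREMS-ONLY ports inline `Subring.inclusion (padicCoeffIntegers_mono h)`).
[cite: EmertonPollackWeston2006, §3.1 (p. 17) (plumbing)] -/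
def inclO (h : S ⊆ S') : padicCoeffIntegers S →+* padicCoeffIntegers S' :=
  Subring.inclusion (padicCoeffIntegers_mono h)

/-- The inclusion `Λ_{𝒪_S} →+* Λ_{𝒪_{S'}}` (coefficientwise; inline `PowerSeries.map (inclO h)`). [cite: Sprung2017, Thm. 1.1 (plumbing)] -/
def inclΛ (h : S ⊆ S') : IwasawaAlgebraO S →+* IwasawaAlgebraO S' :=
  PowerSeries.map (inclO h)

@[simp] theorem coe_inclO (h : S ⊆ S') (x : padicCoeffIntegers S) :
    ((inclO h x : padicCoeffIntegers S') : PadicAlgCl p) = x :=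
  Subring.coe_inclusion (padicCoeffIntegers_mono h) x

@[simp] theorem coeff_inclΛ (h : S ⊆ S') (L : IwasawaAlgebraO S) (k : ℕ) :
    PowerSeries.coeff k (inclΛ h L) = inclO h (PowerSeries.coeff k L) := by
  rw [inclΛ, PowerSeries.coeff_map]

theorem inclΛ_C (h : S ⊆ S') (c : padicCoeffIntegers S) : inclΛ h (PowerSeries.C c) = PowerSeries.C (inclO h c) := by
  rw [inclΛ, PowerSeries.map_C]

/-- `inclΛ` is invisible in `ℚ̄_p⟦T⟧`. [cite: Sprung2017, Thm. 1.1 (plumbing)] -/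
@[simp] theorem iwasawaOToPowerSeries_inclΛ (h : S ⊆ S') (L : IwasawaAlgebraO S) :
    iwasawaOToPowerSeries S' (inclΛ h L) = iwasawaOToPowerSeries S L := by
  ext k
  rw [coeff_iwasawaOToPowerSeries, coeff_iwasawaOToPowerSeries, coeff_inclΛ, coe_inclO]

theorem inclΛ_injective (h : S ⊆ S') : Function.Injective (inclΛ h) := fun L₁ L₂ e ↦ by
  apply iwasawaOToPowerSeries_injective S
  rw [← iwasawaOToPowerSeries_inclΛ h, ← iwasawaOToPowerSeries_inclΛ h, e]

/-- `ι_Λ (C c) = C ↑c`. [cite: Sprung2017, Thm. 1.1 (plumbing)] -/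
@[simp] theorem iwasawaOToPowerSeries_C (c : padicCoeffIntegers S) :
    iwasawaOToPowerSeries S (PowerSeries.C c) = PowerSeries.C (c : PadicAlgCl p) := by
  rw [iwasawaOToPowerSeries, PowerSeries.map_C, Subring.coe_subtype]

/-- `inclΛ` fixes (the power series of) integer polynomials — in particular `ω_n`, `±ω_n^±`. [folklore] -/
theorem inclΛ_coe_map (h : S ⊆ S') (P : ℤ[X]) :
    inclΛ h ((P.map (Int.castRingHom (padicCoeffIntegers S)) : (padicCoeffIntegers S)[X]) : IwasawaAlgebraO S) =
      ((P.map (Int.castRingHom (padicCoeffIntegers S')) : (padicCoeffIntegers S')[X]) : IwasawaAlgebraO S') := by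
  apply iwasawaOToPowerSeries_injective S'
  rw [iwasawaOToPowerSeries_inclΛ, iwasawaOToPowerSeries_coe_map, iwasawaOToPowerSeries_coe_map]

/-- **Congruences `mod ω_n` in `Λ_𝒪 ⊗ ℚ` are insensitive to enlarging `𝒪`.** [cite: Sprung2017, Cor. 4.4 (shape)] -/
theorem IsCongrModOmegaO.of_subset (h : S ⊆ S') {n : ℕ} {θ : (PadicAlgCl p)[X]} {L : PowerSeries (PadicAlgCl p)}
    (hc : IsCongrModOmegaO S n θ L) : IsCongrModOmegaO S' n θ L := by
  obtain ⟨m, q, e⟩ := hc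
  exact ⟨m, inclΛ h q, by rwa [iwasawaOToPowerSeries_inclΛ]⟩

end BaseChange

/-! ## §B The even Mazur–Tate congruences of an `𝒪`-Pollack pair over any `S' ⊇ range ι` -/

section Pollack

variable {M : ℕ} {g : CuspForm (Gamma0 M) 2} {ι : coeffField g →+* PadicAlgCl p} {Ω : ℂ}

/-- [cite: Pollack2003, Thm. 5.6 and Prop. 6.18 (shape)] -/
theorem IsPollackPairK.even_congr_of_subset {S' : Set (PadicAlgCl p)} (h : Set.range ι ⊆ S')
    {Lp Lm : IwasawaAlgebraO (Set.range ι)} (hL : IsPollackPairK g ι Ω Lp Lm) (n : ℕ) (hn : Even n) :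
    IsCongrModOmegaO S' n ((mazurTateElementK g Ω p n).map ι)
      (((((-1) ^ (n / 2 + 1) * cyclotomicOmegaMinus p n).map (Int.castRingHom (PadicAlgCl p)) :
          (PadicAlgCl p)[X]) : PowerSeries (PadicAlgCl p)) * iwasawaOToPowerSeries S' (inclΛ h Lm)) := by
  rw [iwasawaOToPowerSeries_inclΛ]
  exact IsCongrModOmegaO.of_subset h (hL.2.2.2 n hn)

end Pollack

/-! ## §C The relay K-β over a GENERIC coefficient set `S` and a generic left family `θ` -/

section Relay

variable {S : Set (PadicAlgCl p)}

/-- **K-β, Λ-multiplier form, generic `S` and `θ`.** If `θ m ≡ (−1)^{m+1}ω⁻_{2m}·L⁻ (mod ω_{2m})` in `Λ_𝒪 ⊗ ℚ` for all `m` (the even half of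
a Pollack pair, over ANY `𝒪 = 𝒪_S`), the column congruences `ω_{2m} ∣ Q_m + (−1)^m ω⁻_{2m} E` hold and MTV_Λ `μt·θ m ≡ ν·w·Q_m (mod ω_{2m})`
holds, then `C ν · w · E = μt · L⁻`. Verbatim port of the landed `C_mul_mul_eq_mul_of_congruences` (`S = range ι`, `θ m = θ_{2m}(g)^ι`).
[cite: Pollack2003, Thm. 5.1 and Prop. 6.18] [cite: Kato2004Asterisque, Thm. 12.5 (1) (p. 221)] -/
theorem C_mul_mul_eq_mul_of_congruences_gen [FiniteDimensional ℚ_[p] (padicCoeffField S)]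
    (θ : ℕ → (PadicAlgCl p)[X]) (Lm : IwasawaAlgebraO S)
    (heven : ∀ m : ℕ, IsCongrModOmegaO S (2 * m) (θ m)
      (((((-1) ^ (2 * m / 2 + 1) * cyclotomicOmegaMinus p (2 * m)).map (Int.castRingHom (PadicAlgCl p)) :
          (PadicAlgCl p)[X]) : PowerSeries (PadicAlgCl p)) * iwasawaOToPowerSeries S Lm))
    (E : IwasawaAlgebraO S) (Q : ℕ → IwasawaAlgebraO S)
    (μt : IwasawaAlgebraO S) (ν : padicCoeffIntegers S) (w : IwasawaAlgebraO S)
    (hcol : ∀ m : ℕ, (((cyclotomicOmega p (2 * m)).map (Int.castRingHom (padicCoeffIntegers S)) :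
        (padicCoeffIntegers S)[X]) : IwasawaAlgebraO S) ∣
      Q m + ((((-1) ^ m * cyclotomicOmegaMinus p (2 * m)).map (Int.castRingHom (padicCoeffIntegers S)) :
        (padicCoeffIntegers S)[X]) : IwasawaAlgebraO S) * E)
    (hMT : ∀ m : ℕ, ∃ (k : ℕ) (q : IwasawaAlgebraO S),
      PowerSeries.C ((p : PadicAlgCl p) ^ k) *
          (iwasawaOToPowerSeries S μt * ((θ m : (PadicAlgCl p)[X]) : PowerSeries (PadicAlgCl p)) -
            iwasawaOToPowerSeries S (PowerSeries.C ν * w * Q m)) =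
        (((cyclotomicOmega p (2 * m)).map (Int.castRingHom (PadicAlgCl p)) : (PadicAlgCl p)[X]) : PowerSeries (PadicAlgCl p)) *
          iwasawaOToPowerSeries S q) :
    PowerSeries.C ν * w * E = μt * Lm := by
  haveI : IsDiscreteValuationRing (padicCoeffIntegers S) := isDiscreteValuationRing_padicCoeffIntegers
  haveI : CharP (IsLocalRing.ResidueField (padicCoeffIntegers S)) p := charP_residueField_padicCoeffIntegers
  have hsign : ∀ n : ℕ, ((-1 : ℤ[X]) ^ (n / 2 + 1)) = 1 ∨ ((-1 : ℤ[X]) ^ (n / 2 + 1)) = -1 :=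
    fun n ↦ neg_one_pow_eq_or ℤ[X] (n / 2 + 1)
  -- (c) multiplied by `μt`: `μt θ m ≡ ((-1)^{m+1} ω⁻_{2m}) · (μt L⁻)`
  have h₁ : ∀ m : ℕ, ∃ (k : ℕ) (q : IwasawaAlgebraO S),
      PowerSeries.C ((p : PadicAlgCl p) ^ k) *
          (iwasawaOToPowerSeries S μt * ((θ m : (PadicAlgCl p)[X]) : PowerSeries (PadicAlgCl p)) -
            (((((-1) ^ (2 * m / 2 + 1) * cyclotomicOmegaMinus p (2 * m)).map (Int.castRingHom (PadicAlgCl p)) :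
              (PadicAlgCl p)[X]) : PowerSeries (PadicAlgCl p)) * iwasawaOToPowerSeries S (μt * Lm))) =
        (((cyclotomicOmega p (2 * m)).map (Int.castRingHom (PadicAlgCl p)) : (PadicAlgCl p)[X]) : PowerSeries (PadicAlgCl p)) *
          iwasawaOToPowerSeries S q :=
    fun m ↦ congr_mul_of_isCongrModOmegaO (heven m) μt
  -- (a)+(b): `μt θ m ≡ ν w Q_m ≡ ((-1)^{m+1} ω⁻_{2m}) · (ν w E)` — the second step is an INTEGRAL congruence
  have h₂ : ∀ m : ℕ, ∃ (k : ℕ) (q : IwasawaAlgebraO S),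
      PowerSeries.C ((p : PadicAlgCl p) ^ k) *
          (iwasawaOToPowerSeries S μt * ((θ m : (PadicAlgCl p)[X]) : PowerSeries (PadicAlgCl p)) -
            (((((-1) ^ (2 * m / 2 + 1) * cyclotomicOmegaMinus p (2 * m)).map (Int.castRingHom (PadicAlgCl p)) :
              (PadicAlgCl p)[X]) : PowerSeries (PadicAlgCl p)) * iwasawaOToPowerSeries S (PowerSeries.C ν * w * E))) =
        (((cyclotomicOmega p (2 * m)).map (Int.castRingHom (PadicAlgCl p)) : (PadicAlgCl p)[X]) : PowerSeries (PadicAlgCl p)) *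
          iwasawaOToPowerSeries S q := by
    intro m
    have hc : ((-1 : ℤ[X]) ^ (2 * m / 2 + 1) * cyclotomicOmegaMinus p (2 * m)) =
        -((-1) ^ m * cyclotomicOmegaMinus p (2 * m)) := by
      rw [Nat.mul_div_cancel_left m two_pos, pow_succ]; ring
    have key := congr_of_dvd_sub (hMT m)
      (L₂ := ((((-1) ^ (2 * m / 2 + 1) * cyclotomicOmegaMinus p (2 * m)).map
          (Int.castRingHom (padicCoeffIntegers S)) : (padicCoeffIntegers S)[X]) :
            IwasawaAlgebraO S) * (PowerSeries.C ν * w * E))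
      (by
        obtain ⟨r, hr⟩ := hcol m
        refine ⟨PowerSeries.C ν * w * r, ?_⟩
        rw [hc, Polynomial.map_neg, Polynomial.coe_neg]
        linear_combination (PowerSeries.C ν * w) * hr)
    simpa only [map_mul, iwasawaOToPowerSeries_coe_map] using key
  -- rigidity: `T ω⁺_{2m} ∣ ν w E − μt L⁻` for all `m`, and `⋂ (T ω⁺_{2m}) = 0`
  rw [← sub_eq_zero]
  refine eq_zero_of_forall_dvd_of_map_eq_X_pow (O := padicCoeffIntegers S)
    (fun m : ℕ ↦ (((X * cyclotomicOmegaPlus p (2 * m)).map (Int.castRingHom (padicCoeffIntegers S)) :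
      (padicCoeffIntegers S)[X]) : IwasawaAlgebraO S))
    (fun m ↦ (X * cyclotomicOmegaPlus p (2 * m)).natDegree)
    (fun m ↦ map_residue_coe_eq_X_pow p (Polynomial.monic_X.mul (monic_cyclotomicOmegaPlus p _))
      (X_mul_cyclotomicOmegaPlus_dvd p _))
    (fun k ↦ ⟨k, ?_⟩) (fun m ↦ ?_)
  · rw [Polynomial.monic_X.natDegree_mul (monic_cyclotomicOmegaPlus p _), Polynomial.natDegree_X]
    have := le_natDegree_cyclotomicOmegaPlus p k
    omega
  · exact dvd_sub_of_congr_powerSeries (S := S) (hsign (2 * m)) (Polynomial.monic_X.mul (monic_cyclotomicOmegaPlus p _))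
      (monic_cyclotomicOmegaMinus p _) (X_mul_cyclotomicOmegaPlus_mul_cyclotomicOmegaMinus p (2 * m)).symm
      (h₁ m) (h₂ m)

end Relay

/-! ## §D The rescaled values constant `u := p^a · q` is integral in `ℚ_p(S ∪ {q})` -/

section Constant

variable {S : Set (PadicAlgCl p)}

/-- `q ∈ ℚ_p(S ∪ {q})`. [cite: EmertonPollackWeston2006, §3.1 (p. 17) (plumbing)] -/
theorem mem_padicCoeffField_union_singleton (S : Set (PadicAlgCl p)) (q : PadicAlgCl p) :
    q ∈ padicCoeffField (S ∪ {q}) :=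
  IntermediateField.subset_adjoin ℚ_[p] _ (Set.mem_union_right S rfl)

/-- **`p^a · q ∈ 𝒪_S` for `q ∈ ℚ_p(S)` and `a` large** (`𝒪_S[1/p] = ℚ_p(S)`). [cite: EmertonPollackWeston2006, §3.1 (p. 17)] -/
theorem exists_natCast_pow_mul_mem_padicCoeffIntegers {q : PadicAlgCl p} (hq : q ∈ padicCoeffField S) :
    ∃ a : ℕ, (p : PadicAlgCl p) ^ a * q ∈ padicCoeffIntegers S := by
  have hp1 : (1 : ℝ) < p := by exact_mod_cast hp.out.one_lt
  have hp0 : (0 : ℝ) < p := lt_trans zero_lt_one hp1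
  obtain ⟨a, ha⟩ := pow_unbounded_of_one_lt ‖q‖ hp1
  refine ⟨a, mul_mem (pow_mem (natCast_mem (padicCoeffField S) p) a) hq, ?_⟩
  have hnp : ‖(p : PadicAlgCl p)‖ = (p : ℝ)⁻¹ := by
    rw [← map_natCast (algebraMap ℚ_[p] (PadicAlgCl p)) p]
    change ‖((p : ℚ_[p]) : PadicAlgCl p)‖ = _
    rw [PadicAlgCl.norm_extends, Padic.norm_p]
  rw [norm_mul, norm_pow, hnp, inv_pow, inv_mul_le_iff₀ (pow_pos hp0 a), mul_one]
  exact ha.le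

end Constant

/-! ## §E One-coefficient descent `Λ_{𝒪'} → Λ_𝒪` -/

section Descent

variable {S S' : Set (PadicAlgCl p)}

/-- **One-coefficient descent.** If `F, G ∈ Λ_{𝒪_S}`, `G ≠ 0`, and `F = C u · G` holds in `Λ_{𝒪_{S'}}` (`S ⊆ S'`, `u ∈ 𝒪_{S'}`), then `u ∈ 𝒪_S`
(compare ONE coefficient where `G_k ≠ 0`: `u = F_k / G_k ∈ ℚ_p(S)`, `‖u‖ ≤ 1`) and `F = C u · G` already in `Λ_{𝒪_S}`. [folklore] -/
theorem exists_eq_C_mul_of_inclΛ_eq (h : S ⊆ S') {F G : IwasawaAlgebraO S} {u : padicCoeffIntegers S'} (hG : G ≠ 0)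
    (e : inclΛ h F = PowerSeries.C u * inclΛ h G) :
    ∃ u₀ : padicCoeffIntegers S, inclO h u₀ = u ∧ F = PowerSeries.C u₀ * G := by
  obtain ⟨k, hk⟩ : ∃ k, PowerSeries.coeff k G ≠ 0 := by
    by_contra hcon
    exact hG (PowerSeries.ext fun k ↦ by rw [map_zero]; exact not_not.1 fun h' ↦ hcon ⟨k, h'⟩)
  have e' : iwasawaOToPowerSeries S F = PowerSeries.C (u : PadicAlgCl p) * iwasawaOToPowerSeries S G := by
    have e₁ := congr_arg (iwasawaOToPowerSeries S') e
    rwa [map_mul, iwasawaOToPowerSeries_inclΛ, iwasawaOToPowerSeries_inclΛ, iwasawaOToPowerSeries_C] at e₁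
  have ek : ((PowerSeries.coeff k F : padicCoeffIntegers S) : PadicAlgCl p) =
      (u : PadicAlgCl p) * ((PowerSeries.coeff k G : padicCoeffIntegers S) : PadicAlgCl p) := by
    have e₂ := congr_arg (PowerSeries.coeff k) e'
    rwa [coeff_iwasawaOToPowerSeries, PowerSeries.coeff_C_mul, coeff_iwasawaOToPowerSeries] at e₂
  have hGk : ((PowerSeries.coeff k G : padicCoeffIntegers S) : PadicAlgCl p) ≠ 0 := by
    rw [Ne, ZeroMemClass.coe_eq_zero]
    exact hk
  have hu : (u : PadicAlgCl p) ∈ padicCoeffIntegers S := by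
    refine ⟨?_, u.2.2⟩
    have : (u : PadicAlgCl p) = ((PowerSeries.coeff k F : padicCoeffIntegers S) : PadicAlgCl p) *
        (((PowerSeries.coeff k G : padicCoeffIntegers S) : PadicAlgCl p))⁻¹ := by
      rw [ek, mul_inv_cancel_right₀ hGk]
    rw [this]
    exact mul_mem (PowerSeries.coeff k F).2.1 (inv_mem (PowerSeries.coeff k G).2.1)
  refine ⟨⟨u, hu⟩, Subtype.ext (coe_inclO h ⟨(u : PadicAlgCl p), hu⟩), ?_⟩
  apply iwasawaOToPowerSeries_injective S
  rw [e', map_mul, iwasawaOToPowerSeries_C]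

end Descent

/-! ## §F The packaged q-elimination: relay over `S' ⊇ range ι` with multiplier `C u · μt`, then descend -/

section Package

variable {M : ℕ} {g : CuspForm (Gamma0 M) 2} {ι : coeffField g →+* PadicAlgCl p} {Ω : ℂ}

/-- **q-elimination (road R-q1 of the card).** `(L⁺, L⁻)` an `𝒪`-Pollack pair over `𝒪 = 𝒪_{range ι}`; `E, Q_m, μt ≠ 0, ν, w` over `𝒪`
with the column congruences; `u ∈ 𝒪_{S'}` for some finite-dimensional `S' ⊇ range ι` (e.g. `u = 2^a·q`, `S' = range ι ∪ {q}`); MTV_Λ over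
`S'` with the multiplier `C u · μt`: `(C u·μt)·θ_{2m}(g)^ι ≡ ν·w·Q_m (mod ω_{2m})`. THEN `u ∈ 𝒪` and `C ν · w · E = C u · μt · L⁻` over `𝒪` —
station (R) of the (i)-half interior with `D := C u · μt`, and the K-rationality of the values constant as a COROLLARY, not an input.
[cite: Kato2004Asterisque, Thm. 12.5 (1) (p. 221) and Thm. 16.6.2 (p. 268)] [cite: Pollack2003, Prop. 6.18] -/
theorem relay_descends {S' : Set (PadicAlgCl p)} [FiniteDimensional ℚ_[p] (padicCoeffField S')]
    (h : Set.range ι ⊆ S') {Lp Lm : IwasawaAlgebraO (Set.range ι)} (hL : IsPollackPairK g ι Ω Lp Lm)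
    (E : IwasawaAlgebraO (Set.range ι)) (Q : ℕ → IwasawaAlgebraO (Set.range ι))
    (μt : IwasawaAlgebraO (Set.range ι)) (hμ : μt ≠ 0) (ν : padicCoeffIntegers (Set.range ι)) (w : IwasawaAlgebraO (Set.range ι))
    (u : padicCoeffIntegers S')
    (hcol : ∀ m : ℕ, (((cyclotomicOmega p (2 * m)).map (Int.castRingHom (padicCoeffIntegers (Set.range ι))) :
        (padicCoeffIntegers (Set.range ι))[X]) : IwasawaAlgebraO (Set.range ι)) ∣
      Q m + ((((-1) ^ m * cyclotomicOmegaMinus p (2 * m)).map (Int.castRingHom (padicCoeffIntegers (Set.range ι))) :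
        (padicCoeffIntegers (Set.range ι))[X]) : IwasawaAlgebraO (Set.range ι)) * E)
    (hMT : ∀ m : ℕ, ∃ (k : ℕ) (q' : IwasawaAlgebraO S'),
      PowerSeries.C ((p : PadicAlgCl p) ^ k) *
          (iwasawaOToPowerSeries S' (PowerSeries.C u * inclΛ h μt) *
              (((mazurTateElementK g Ω p (2 * m)).map ι : (PadicAlgCl p)[X]) : PowerSeries (PadicAlgCl p)) -
            iwasawaOToPowerSeries S' (inclΛ h (PowerSeries.C ν * w * Q m))) =
        (((cyclotomicOmega p (2 * m)).map (Int.castRingHom (PadicAlgCl p)) : (PadicAlgCl p)[X]) : PowerSeries (PadicAlgCl p)) *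
          iwasawaOToPowerSeries S' q') :
    ∃ u₀ : padicCoeffIntegers (Set.range ι), inclO h u₀ = u ∧ PowerSeries.C ν * w * E = PowerSeries.C u₀ * μt * Lm := by
  -- the relay over `S'`
  have hcol' : ∀ m : ℕ, (((cyclotomicOmega p (2 * m)).map (Int.castRingHom (padicCoeffIntegers S')) :
        (padicCoeffIntegers S')[X]) : IwasawaAlgebraO S') ∣
      inclΛ h (Q m) + ((((-1) ^ m * cyclotomicOmegaMinus p (2 * m)).map (Int.castRingHom (padicCoeffIntegers S')) :
        (padicCoeffIntegers S')[X]) : IwasawaAlgebraO S') * inclΛ h E := by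
    intro m
    have := map_dvd (inclΛ h) (hcol m)
    rwa [map_add, map_mul, inclΛ_coe_map, inclΛ_coe_map] at this
  have hMT' : ∀ m : ℕ, ∃ (k : ℕ) (q' : IwasawaAlgebraO S'),
      PowerSeries.C ((p : PadicAlgCl p) ^ k) *
          (iwasawaOToPowerSeries S' (PowerSeries.C u * inclΛ h μt) *
              (((mazurTateElementK g Ω p (2 * m)).map ι : (PadicAlgCl p)[X]) : PowerSeries (PadicAlgCl p)) -
            iwasawaOToPowerSeries S' (PowerSeries.C (inclO h ν) * inclΛ h w * inclΛ h (Q m))) =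
        (((cyclotomicOmega p (2 * m)).map (Int.castRingHom (PadicAlgCl p)) : (PadicAlgCl p)[X]) : PowerSeries (PadicAlgCl p)) *
          iwasawaOToPowerSeries S' q' := by
    intro m
    obtain ⟨k, q', e⟩ := hMT m
    refine ⟨k, q', ?_⟩
    have hsplit : inclΛ h (PowerSeries.C ν * w * Q m) = PowerSeries.C (inclO h ν) * inclΛ h w * inclΛ h (Q m) := by
      rw [map_mul, map_mul, inclΛ_C]
    rwa [hsplit] at e
  have key := C_mul_mul_eq_mul_of_congruences_gen (S := S') (fun m ↦ (mazurTateElementK g Ω p (2 * m)).map ι) (inclΛ h Lm)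
    (fun m ↦ IsPollackPairK.even_congr_of_subset h hL (2 * m) ⟨m, two_mul m⟩) (inclΛ h E) (fun m ↦ inclΛ h (Q m))
    (PowerSeries.C u * inclΛ h μt) (inclO h ν) (inclΛ h w) hcol' hMT'
  -- descend by one coefficient of `μt · L⁻ ≠ 0`
  have hG : μt * Lm ≠ 0 := mul_ne_zero hμ hL.2.1
  have e : inclΛ h (PowerSeries.C ν * w * E) = PowerSeries.C u * inclΛ h (μt * Lm) := by
    have hsplit : inclΛ h (PowerSeries.C ν * w * E) = PowerSeries.C (inclO h ν) * inclΛ h w * inclΛ h E := by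
      rw [map_mul, map_mul, inclΛ_C]
    rw [hsplit, key, map_mul, mul_assoc]
  obtain ⟨u₀, hu₀, hF⟩ := exists_eq_C_mul_of_inclΛ_eq h hG e
  exact ⟨u₀, hu₀, by rw [hF, mul_assoc]⟩

/-- **Corollary: the values constant is `K`-rational up to the rescaling** — `u = 2^a q ∈ 𝒪_{range ι}`, so `q ∈ K = ℚ_p(range ι)`.
[cite: Kato2004Asterisque, Thm. 12.5 (1) (p. 221) (`z_γ^{(p)} ∈ H¹(ℤ[1/p], T ⊗ Λ) ⊗ Q(Λ)` with `O_λ`-coefficients)] -/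
theorem mem_padicCoeffField_of_natCast_pow_mul_mem {S : Set (PadicAlgCl p)} {q : PadicAlgCl p} {a : ℕ}
    (hu : (p : PadicAlgCl p) ^ a * q ∈ padicCoeffIntegers S) : q ∈ padicCoeffField S := by
  have hp0 : ((p : PadicAlgCl p) ^ a) ≠ 0 := pow_ne_zero a (by exact_mod_cast hp.out.ne_zero)
  have : q = ((p : PadicAlgCl p) ^ a)⁻¹ * ((p : PadicAlgCl p) ^ a * q) := by
    rw [inv_mul_cancel_left₀ hp0]
  rw [this]
  exact mul_mem (inv_mem (pow_mem (natCast_mem (padicCoeffField S) p) a)) hu.1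

end Package

end Summit.BirchSwinnertonDyer.BirchSwinnertonDyer.Cruxes.ResidualThetaCountLowerPureAtTwo.SideaK1G26

end
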